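import Summits.ValiantsHypothesis.ValiantsHypothesis.Theses.FermionizationDimension
import Summits.ValiantsHypothesis.ValiantsHypothesis.Theses.TwistedDetRank
import Summits.ValiantsHypothesis.ValiantsHypothesis.Theorems.FermionizationDimensionSDimPerNotQPJunkRigidityReduced
import Summits.ValiantsHypothesis.ValiantsHypothesis.Theorems.FermionizationDimensionSDimPerNotQPJunkRigidityTransferLarge
import Summits.ValiantsHypothesis.ValiantsHypothesis.Theorems.FermionizationDimensionSDimPerNotQPLocalExpansion
import Summits.ValiantsHypothesis.ValiantsHypothesis.Theorems.FermionizationDimensionSDimPerNotQPGlobalExpansion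
import Summits.ValiantsHypothesis.ValiantsHypothesis.Theorems.FermionizationDimensionSDimPerNotQP
import Summits.ValiantsHypothesis.ValiantsHypothesis.Theorems.FermionizationDimensionSDimPerNotQPExpansionBound
import Summits.ValiantsHypothesis.ValiantsHypothesis.Theorems.FermionizationDimensionSDimPerNotQPPolylogTransfer
import Summits.ValiantsHypothesis.ValiantsHypothesis.Theorems.FermionizationDimensionSDimPerNotQPSuperpolyTransfer
import Summits.ValiantsHypothesis.ValiantsHypothesis.Theorems.FermionizationDimensionSDimPerNotQPBetOrSemisimple
import Summits.ValiantsHypothesis.ValiantsHypothesis.Theorems.FermionizationDimensionSDimPerNotQPDirectSumExpTransfer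
import Summits.ValiantsHypothesis.ValiantsHypothesis.Theorems.FermionizationDimensionSDimPerNotQPExpansionNil
import Summits.ValiantsHypothesis.ValiantsHypothesis.Theorems.FermionizationDimensionSDimPerNotQPLinearLowerBound
import Summits.ValiantsHypothesis.ValiantsHypothesis.Theorems.TwistedDetRankTdrPerNotQP

/-!
# Lead skeleton — crux `SDimPerNotQP` (item `stmt-ValiantsHypothesis-7286`), line `registered` (ex `birth`), rev 10

REV 10 (lead c1, 2026-08-17): THE CRUX IS PROVED MODULO ONE PROVABLE-NOW STUB, `stub_expLowerBound`
(every commutative realisation of `sgn_{3m}` has `3^m ≤ 2^m · finrank ℂ R` — the determinantal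
flattening of the Birkhoff cubic evaluated on `R`-points: factorisation through `R²` at unit entries,
polynomial perturbation for nilpotent ones; proof CHECKED sorry-free in
`work/stubs/ExpLowerBound.lean`, landing as
`Theorems/FermionizationDimensionSDimPerNotQPExpLowerBound.lean`). New composition
`SDimPerNotQP_of : Registered.stub_expLowerBound → SDimPerNotQP` (arithmetic: `stub_expBeatsQP`,
`tdrPerNotQP_qp_transfer`, both landed for the sibling crux). The sibling crux `TdrPerNotQP`
(stmt-6284) is meanwhile PROVED in tree, so `stub_tdrPerNotQP` is closed by `tdrPerNotQP_proof`; the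
bet `stub_junkRigidityTransferSmall` is no longer needed (its registered theorem is withdrawn; the
old composition survives as the conditional `SDimPerNotQP_of_semisimple`).

REV 9 (lead c1, 2026-08-17): two auxiliary stubs added and proved in the work folder —
`stub_linearLowerBound` (every commutative realisation of `sgn_n` has `n ≤ 2 · finrank ℂ R`:
`s(n) ≥ ⌈n/2⌉`, the first lower bound beyond Marcus–Minc) and its corollary `stub_sDimUnbounded`
(= the route's rank-4 crux `SDimUnbounded`, stmt-ValiantsHypothesis-7288). The composition and its two
open stubs are unchanged.


Route `route-ValiantsHypothesis-FermionizationDimension`, crux (rank 2), BY NAME: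
`Summit.ValiantsHypothesis.ValiantsHypothesis.Theses.FermionizationDimension.SDimPerNotQP` —
the commutative twisting ("fermionization") dimension `s(n)` of the permanent is not
quasi-polynomially bounded: for every qp-bounded `s` there is an `n` such that every commutative
finite-dimensional `ℂ`-algebra `R` with `u ∈ R^{n×n}`, `ℓ ∈ R^*` realising
`ℓ(∏ i, u (σ i) i) = sgn σ` (all `σ ∈ S_n`) has `finrank ℂ R > s n`.

LINE (unchanged idea, the route header's TWO-LAYER PLAN "SDimPerNotQP ⇐ SemisimpleExp →
JunkRigidity"): a lower bound in the SEMISIMPLE sub-model (sums of Hadamard-twisted determinants =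
realisations over `ℂ^r`) plus the transfer "nilpotents buy at most a quasi-polynomial factor over
idempotents". REV 2 (lead reshape, 2026-08-17): the birth stub J = `JunkRigidityQP`
(realisation ↦ short twisted-determinantal representation) was two things glued together and is
split at the skeleton level into

* `stub_junkRigidityReduced` (J_red, PROVABLE NOW, size M) — the semisimple bookkeeping: a
  realisation of `sgn_n` over a REDUCED commutative f.d. `ℂ`-algebra `R` gives
  `per_n = Σ_{t<r} det(X ∘ E_t)` with `r ≤ finrank ℂ R` (Artin–Wedderburn / `IsArtinianRing.equivPi`:
  `R ≅ ℂ^{MaxSpec R}` through its characters `χ_I`, `ℓ = Σ_I a_I χ_I`, `E_I = χ_I ∘ u`, scalars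
  absorbed into a column for `n ≥ 1`; `n = 0`: `r = 1`);
* `stub_junkRigidityTransfer` (J_tr, the route's BET, conjecture-grade) — semisimplification at
  quasi-polynomial cost, realisation by realisation: an absolute `c` such that every commutative
  realisation `(R, u, ℓ)` of `sgn_n` yields a realisation over a REDUCED algebra `R'` with
  `finrank R' ≤ 2^((log₂(finrank R + n) + c)^c)` — the only place where the nilpotent / scheme
  structure of `R` is met ("an ideal of small colength meeting the transversal span inside `ker sgn`
  degenerates, border-apolarity style, to boundedly many reduced points");

and `junkRigidityQP_of : J_red → J_tr → JunkRigidityQP` is PROVED here. The semisimple lower bound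
is unchanged:

* `stub_tdrPerNotQP` (X1_ss) — VERBATIM the signature of item `stmt-ValiantsHypothesis-6284`
  (`TwistedDetRank.TdrPerNotQP`, open crux rank 3 of the sibling route): a proof landed there
  closes this stub by `exact`. It is a CONSEQUENCE of the crux (a length-`r` twisted representation
  is a realisation over `Fin r → ℂ`; landed separately as a `--supports` helper
  `tdrPerNotQP_of_sDimPerNotQP`), i.e. the weaker-model half of the split.

ASSEMBLY (rev 5). `SDimPerNotQP_of : Registered.stub_tdrPerNotQP →
Registered.stub_junkRigidityTransferSmall → SDimPerNotQP` is PROVED (sorry-free): J_tr,small with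
the landed J_tr,large gives J_tr (`junkRigidityTransfer_of`, constant `max c 2`), J_tr with the
landed J_red gives J (`junkRigidityQP_of`), and J with X1_ss gives the crux exactly as at birth
(`qp_compose`: `log₂(2^A + n) ≤ A + log₂ n + 2` and exponent absorption). Sorries: the two open
composition stubs plus the three auxiliary calibration stubs of §2 until they land; zero elsewhere.

LANDED so far (all `--supports stmt-ValiantsHypothesis-7286`): J_red p147106, necessity
`tdrPerNotQP_of_sDimPerNotQP` p150328, J_tr,large p151357, LocalExpansion p152060,
GlobalExpansion p152485, ExpansionBound p152874, PolylogTransfer p153231, SuperpolyTransfer p153298,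
BetOrSemisimple p153546, DirectSumExpTransfer (DirectSumExp → superpoly tdr → SDimUnbounded) p154123,
ExpansionNil (nil-index exponent) p154689.

Disproof used: none exists (`ledger crux ls stmt-ValiantsHypothesis-7286` 2026-08-17: Lines/birth.*,
PICKED.md only — no `Disproof.lean`, no `_false_without_` theorem, no `Theorems/SDimPerNotQP/Negative/*`).
Dead lines: none.
-/

set_option linter.dupNamespace false

namespace Summit.ValiantsHypothesis.ValiantsHypothesis.Cruxes.SDimPerNotQP.Birth

open Summit.ValiantsHypothesis.ValiantsHypothesis.Theses.FermionizationDimension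

/-! ## §1 The stub statements (named, def-free over tree declarations) -/

/-- **X1_ss — the twisted-determinantal rank of the permanent is not quasi-polynomially bounded**
(verbatim the signature of the sibling item `TwistedDetRank.TdrPerNotQP`, stmt-ValiantsHypothesis-6284):
`sgn ∈ ℂ^{S_n}` is not a sum of quasi-polynomially many points `π ↦ ∏ i, E (π i) i` of the Birkhoff
cone. [conjecture-grade; MarcusMinc1961 (r = 1 impossible), MignonRessayre2004, LoeblMasbaum2011,
Tesler2000; in tree: ⌊n/3⌋+1 ≤ tdr(per_n) ≤ n!] -/
def TdrPerNotQP : Prop :=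
  ¬ ∃ c : ℕ, ∀ n : ℕ, ∃ r ≤ 2 ^ ((Nat.log 2 n + c) ^ c), ∃ E : Fin r → Matrix (Fin n) (Fin n) ℂ, Literature.Computability.AlgebraicComplexity.perPoly (Fin n) ℂ = ∑ t, (Matrix.of fun i j => MvPolynomial.C (E t i j) * MvPolynomial.X (i, j)).det

/-- **J — junk rigidity at quasi-polynomial cost** (the birth stub, now DERIVED from J_red and
J_tr by `junkRigidityQP_of`): an absolute `c` such that every commutative realisation `(R, u, ℓ)`
of `sgn_n` yields `per_n = Σ_{t<r} det(X ∘ E_t)` with `r ≤ 2^((log₂(finrank ℂ R + n) + c)^c)`.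
[conjecture-grade — the route's bet; IarrobinoKanev1999, BuczynskaBuczynski2021,
RanestadSchreyer2011, Shafiei2015] -/
def JunkRigidityQP : Prop :=
  ∃ c : ℕ, ∀ (n : ℕ) (R : Type) [CommRing R] [Algebra ℂ R] [Module.Finite ℂ R] (u : Fin n → Fin n → R) (ℓ : R →ₗ[ℂ] ℂ), (∀ σ : Equiv.Perm (Fin n), ℓ (∏ i, u (σ i) i) = ((Equiv.Perm.sign σ : ℤ) : ℂ)) → ∃ r ≤ 2 ^ ((Nat.log 2 (Module.finrank ℂ R + n) + c) ^ c), ∃ E : Fin r → Matrix (Fin n) (Fin n) ℂ, Literature.Computability.AlgebraicComplexity.perPoly (Fin n) ℂ = ∑ t, (Matrix.of fun i j => MvPolynomial.C (E t i j) * MvPolynomial.X (i, j)).det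

/-- **J_red — the reduced (semisimple) case, exact**: a realisation of `sgn_n` over a REDUCED
commutative finite-dimensional `ℂ`-algebra `R` is a sum of at most `finrank ℂ R` Hadamard-twisted
determinants. Proof route: `IsArtinianRing.of_finite ℂ R`; `IsArtinianRing.equivPi R : R ≃ₐ[R]
Π I : MaximalSpectrum R, R ⧸ I` (Mathlib); each residue field is finite over `ℂ`, hence `= ℂ`
(`IsAlgClosed`), giving characters `χ_I : R →ₐ[ℂ] ℂ` with `R ≅ ℂ^{MaxSpec R}`; then
`ℓ = Σ_I ℓ(e_I) χ_I` and `sgn σ = Σ_I ℓ(e_I) ∏ i, χ_I (u (σ i) i)`; absorb the scalars into column `0`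
(`n ≥ 1`, `TwistedDetRankTdrSuperadditive.exists_rep_of_smul_rep`) and pass to polynomials by
`TwistedDetRankTdrSuperadditive.perPoly_eq_sum_twistedDet_iff`; `n = 0`: `r = 1 ≤ finrank`
(`ℓ 1 = 1` forces `R` nontrivial). [folklore; Artin–Wedderburn, MarcusMinc1961] -/
def JunkRigidityReduced : Prop :=
  ∀ (n : ℕ) (R : Type) [CommRing R] [Algebra ℂ R] [Module.Finite ℂ R] [IsReduced R] (u : Fin n → Fin n → R) (ℓ : R →ₗ[ℂ] ℂ), (∀ σ : Equiv.Perm (Fin n), ℓ (∏ i, u (σ i) i) = ((Equiv.Perm.sign σ : ℤ) : ℂ)) → ∃ r ≤ Module.finrank ℂ R, ∃ E : Fin r → Matrix (Fin n) (Fin n) ℂ, Literature.Computability.AlgebraicComplexity.perPoly (Fin n) ℂ = ∑ t, (Matrix.of fun i j => MvPolynomial.C (E t i j) * MvPolynomial.X (i, j)).det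

/-- **J_tr — semisimplification at quasi-polynomial cost (the route's bet, load-bearing)**: an
absolute `c` such that every commutative realisation `(R, u, ℓ)` of `sgn_n` yields a realisation
`(R', u', ℓ')` over a REDUCED commutative finite-dimensional `ℂ`-algebra with
`finrank ℂ R' ≤ 2^((log₂(finrank ℂ R + n) + c)^c)` ("nilpotents buy at most a quasi-polynomial
factor over idempotents": an ideal of small colength meeting the transversal span inside `ker sgn`
degenerates to quasi-polynomially many reduced points; route header, TWO-LAYER PLAN, JunkRigidity).
Pointwise in the realisation (NOT the family-level implication, which would be the crux in costume).
Known: true with room to spare whenever `finrank R ≥ 2^{n^δ}` (take the `n!` permutation-matrix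
realisation, `TdrPerFactorial`); every known cheap pattern realised by nilpotents (`ℂ[ε]/ε^k`,
truncated polynomial algebras of bounded embedding dimension) interpolates to polynomially many
points. Why it might fail: nilpotents of large embedding dimension compressing `sgn_n`
super-quasi-polynomially below `tdr(per_n)`. [conjecture-grade; IarrobinoKanev1999,
BuczynskaBuczynski2021, RanestadSchreyer2011, Shafiei2015] -/
def JunkRigidityTransfer : Prop :=
  ∃ c : ℕ, ∀ (n : ℕ) (R : Type) [CommRing R] [Algebra ℂ R] [Module.Finite ℂ R] (u : Fin n → Fin n → R) (ℓ : R →ₗ[ℂ] ℂ), (∀ σ : Equiv.Perm (Fin n), ℓ (∏ i, u (σ i) i) = ((Equiv.Perm.sign σ : ℤ) : ℂ)) → ∃ (R' : Type) (_ : CommRing R') (_ : Algebra ℂ R') (_ : Module.Finite ℂ R') (_ : IsReduced R') (u' : Fin n → Fin n → R') (ℓ' : R' →ₗ[ℂ] ℂ), (∀ σ : Equiv.Perm (Fin n), ℓ' (∏ i, u' (σ i) i) = ((Equiv.Perm.sign σ : ℤ) : ℂ)) ∧ Module.finrank ℂ R' ≤ 2 ^ ((Nat.log 2 (Module.finrank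 ℂ R + n) + c) ^ c)

/-- **J_tr,small — the bet, confined to the sub-exponential regime** (rev 4): the same
semisimplification at quasi-polynomial cost, asked only of realisations with `finrank ℂ R < 2^n`.
This is the whole open content of J_tr: for `finrank ℂ R ≥ 2^n` the `n!` permutation-matrix
representation of `per_n` is already quasi-polynomial in `finrank R + n` (`JunkRigidityTransferLarge`,
provable now). [conjecture-grade; IarrobinoKanev1999, BuczynskaBuczynski2021, RanestadSchreyer2011,
Shafiei2015] -/
def JunkRigidityTransferSmall : Prop :=
  ∃ c : ℕ, ∀ (n : ℕ) (R : Type) [CommRing R] [Algebra ℂ R] [Module.Finite ℂ R] (u : Fin n → Fin n → R) (ℓ : R →ₗ[ℂ] ℂ), (∀ σ : Equiv.Perm (Fin n), ℓ (∏ i, u (σ i) i) = ((Equiv.Perm.sign σ : ℤ) : ℂ)) → Module.finrank ℂ R < 2 ^ n → ∃ (R' : Type) (_ : CommRing R') (_ : Algebra ℂ R') (_ : Module.Finite ℂ R') (_ : IsReduced R') (u' : Fin n → Fin n → R') (ℓ' : R' →ₗ[ℂ] ℂ), (∀ σ : Equiv.Perm (Fin n), ℓ' (∏ i, u' (σ i)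 i) = ((Equiv.Perm.sign σ : ℤ) : ℂ)) ∧ Module.finrank ℂ R' ≤ 2 ^ ((Nat.log 2 (Module.finrank ℂ R + n) + c) ^ c)

/-- **J_tr,large — the trivial regime** (rev 4, provable now): for `d ≥ 2^n` there is a reduced
realisation of `sgn_n` of dimension `n! ≤ 2^(n²) ≤ 2^((log₂(d+n)+2)^2)`, namely `Fin n! → ℂ` read off
`per_n = Σ_τ sgn(τ) det(X ∘ P_τ)` (`TwistedDetRank.TdrPerFactorial`, proved in tree). [folklore] -/
def JunkRigidityTransferLarge : Prop :=
  ∀ (n d : ℕ), 2 ^ n ≤ d → ∃ (R' : Type) (_ : CommRing R') (_ : Algebra ℂ R') (_ : Module.Finite ℂ R') (_ : IsReduced R') (u' : Fin n → Fin n → R') (ℓ' : R' →ₗ[ℂ] ℂ), (∀ σ : Equiv.Perm (Fin n), ℓ' (∏ i, u' (σ i) i) = ((Equiv.Perm.sign σ : ℤ) : ℂ)) ∧ Module.finrank ℂ R' ≤ 2 ^ ((Nat.log 2 (d + n) + 2) ^ 2)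

/-- **Calibration L (local expansion bound, provable now; auxiliary, NOT a hypothesis of the
composition).** Over a LOCAL finite-dimensional commutative `ℂ`-algebra `A` (presented by a character
`χ` with nil kernel) every pattern `σ ↦ ℓ (∏ i, u (σ i) i)` is a scalar combination of at most
`(n+1)^D · D^D` transversal product patterns, `D = finrank ℂ A`: write `u = χ(u)·1 + ν` with `ν`
nilpotent, expand `∏ (λ + ν)` over subsets `S` of columns (`Finset.prod_add`), kill `|S| ≥ D`
(`(ker χ)^D = 0`: a nilpotent ideal of a `D`-dimensional algebra dies in `D` steps), and expand
`ℓ (∏_(i ∈ S) ν_(σ i, i))` in a basis of `A` (`≤ D^|S|` product patterns on `S`). This is the honest,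
EXPONENTIAL-in-`D` content of "nilpotents versus idempotents" by point evaluation / junta expansion
(line card: `C(g + nN, g)`); J_tr claims quasi-polynomial. [folklore] -/
def LocalExpansion : Prop :=
  ∀ (n : ℕ) (A : Type) [CommRing A] [Algebra ℂ A] [Module.Finite ℂ A] (χ : A →ₐ[ℂ] ℂ), (∀ a : A, IsNilpotent (a - algebraMap ℂ A (χ a))) → ∀ (u : Fin n → Fin n → A) (ℓ : A →ₗ[ℂ] ℂ), ∃ (T : Type) (_ : Fintype T) (c : T → ℂ) (E : T → Fin n → Fin n → ℂ), Fintype.card T ≤ (n + 1) ^ Module.finrank ℂ A * Module.finrank ℂ A ^ Module.finrank ℂ A ∧ ∀ σ : Equiv.Perm (Fin n), ℓ (∏ i, u (σ i) i) = ∑ t, c t * ∏ i, E t (σ i) i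

/-- **Calibration G (global expansion bound, provable now; auxiliary).** Over ANY finite-dimensional
commutative `ℂ`-algebra `R`, `d = finrank ℂ R`, every pattern `σ ↦ ℓ (∏ i, u (σ i) i)` is a scalar
combination of at most `(n+1)^d · d^d` transversal product patterns: `R ≅ Π_I R ⧸ P_I^k`
(`IsArtinianRing.quotNilradicalPowEquivPi` with `(nilradical R)^k = 0`), `LocalExpansion` on each
factor, and `Σ_I ((n+1) d)^(d_I) ≤ ((n+1) d)^d`. Consequences (landed separately): a realisation of
`sgn_n` of dimension `d` gives `tdr(per_n) ≤ (n+1)^d d^d`, hence `TdrPerNotQP → s(n)` is not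
polylogarithmically bounded, and `tdr(per_n)` super-polynomial `→ SDimUnbounded`. [folklore] -/
def GlobalExpansion : Prop :=
  ∀ (n : ℕ) (R : Type) [CommRing R] [Algebra ℂ R] [Module.Finite ℂ R] (u : Fin n → Fin n → R) (ℓ : R →ₗ[ℂ] ℂ), ∃ (T : Type) (_ : Fintype T) (c : T → ℂ) (E : T → Fin n → Fin n → ℂ), Fintype.card T ≤ (n + 1) ^ Module.finrank ℂ R * Module.finrank ℂ R ^ Module.finrank ℂ R ∧ ∀ σ : Equiv.Perm (Fin n), ℓ (∏ i, u (σ i) i) = ∑ t, c t * ∏ i, E t (σ i) i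

/-- **Calibration E (expansion bound on `tdr`, provable now; auxiliary).** A commutative
realisation of `sgn_n` of dimension `d` gives `per_n` as a sum of at most `(n+1)^d · d^d`
Hadamard-twisted determinants (`GlobalExpansion` + absorb scalars + compare coefficients):
`tdr(per_n) ≤ (n+1)^(s(n)) s(n)^(s(n))`. [folklore] -/
def ExpansionBound : Prop :=
  ∀ (n : ℕ) (R : Type) [CommRing R] [Algebra ℂ R] [Module.Finite ℂ R] (u : Fin n → Fin n → R) (ℓ : R →ₗ[ℂ] ℂ), (∀ σ : Equiv.Perm (Fin n), ℓ (∏ i, u (σ i) i) = ((Equiv.Perm.sign σ : ℤ) : ℂ)) → ∃ r ≤ (n + 1) ^ Module.finrank ℂ R * Module.finrank ℂ R ^ Module.finrank ℂ R, ∃ E : Fin r → Matrix (Fin n) (Fin n) ℂ, Literature.Computability.AlgebraicComplexity.perPoly (Fin n) ℂ = ∑ t, (Matrix.of fun i j => MvPolynomial.C (E t i j) * MvPolynomial.X (i, j)).det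

/-- **Corollary P (polylog transfer, provable now; auxiliary).** The crux at the POLYLOGARITHMIC
scale follows from X1_ss alone: if `tdr(per_n)` is not quasi-polynomially bounded
(`TwistedDetRank.TdrPerNotQP`, stmt-6284) then `s(n)` is not polylogarithmically bounded — for
every `K` some `n` has all realisations of dimension `> (log₂ n)^K` (`ExpansionBound`:
`d ≤ (log₂ n)^K` would give `tdr(per_n) ≤ (n+1)^d d^d ≤ 2^((log₂ n + K + 3)^(K+3))`). The gap between
this and the crux (quasi-polynomial scale) is exactly what J_tr must supply. [folklore] -/
def PolylogTransfer : Prop :=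
  Summit.ValiantsHypothesis.ValiantsHypothesis.Theses.TwistedDetRank.TdrPerNotQP → ∀ K : ℕ, ∃ n : ℕ, ∀ (R : Type) [CommRing R] [Algebra ℂ R] [Module.Finite ℂ R] (u : Fin n → Fin n → R) (ℓ : R →ₗ[ℂ] ℂ), (∀ σ : Equiv.Perm (Fin n), ℓ (∏ i, u (σ i) i) = ((Equiv.Perm.sign σ : ℤ) : ℂ)) → Nat.log 2 n ^ K < Module.finrank ℂ R

/-- **Corollary U (super-polynomial `tdr` gives `SDimUnbounded`, provable now; auxiliary).** If
`tdr(per_n)` eventually exceeds every polynomial then `s(n) → ∞` (the route's crux `SDimUnbounded`,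
stmt-ValiantsHypothesis-7288): a realisation of dimension `≤ s₀` at `n` forces
`tdr(per_n) ≤ (n+1)^(s₀) s₀^(s₀) ≤ n^(s₀+1)` for large `n` (`ExpansionBound`). In particular the
sibling crux `DirectSumExp` (`tdr(per_n) ≥ 2^(c⌊n/3⌋)`) would settle `SDimUnbounded`. [folklore] -/
def SuperpolyTransfer : Prop :=
  (∀ C : ℕ, ∃ n₀ : ℕ, ∀ n ≥ n₀, ∀ (r : ℕ) (E : Fin r → Matrix (Fin n) (Fin n) ℂ), Literature.Computability.AlgebraicComplexity.perPoly (Fin n) ℂ = ∑ t, (Matrix.of fun i j => MvPolynomial.C (E t i j) * MvPolynomial.X (i, j)).det → n ^ C < r) → Summit.ValiantsHypothesis.ValiantsHypothesis.Theses.FermionizationDimension.SDimUnbounded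

/-- **Calibration D (the two open stubs cannot both fail, provable now; auxiliary).**
J_tr,small ∨ X1_ss: a quasi-polynomial twisted-determinantal representation of every `per_n` (¬X1_ss)
would itself be the cheap REDUCED realisation J_tr,small asks for. So the bet cannot be refuted
without proving the sibling crux stmt-6284, and the line dies only together with X1_ss. [folklore] -/
def BetOrSemisimple : Prop :=
  (∃ c : ℕ, ∀ (n : ℕ) (R : Type) [CommRing R] [Algebra ℂ R] [Module.Finite ℂ R] (u : Fin n → Fin n → R) (ℓ : R →ₗ[ℂ] ℂ), (∀ σ : Equiv.Perm (Fin n), ℓ (∏ i, u (σ i) i) = ((Equiv.Perm.sign σ : ℤ) : ℂ)) → Module.finrank ℂ R < 2 ^ n → ∃ (R' : Type) (_ : CommRing R') (_ : Algebra ℂ R') (_ : Module.Finite ℂ R') (_ : IsReduced R') (u' : Fin n → Fin n → R') (ℓ' : R' →ₗ[ℂ] ℂ), (∀ σ : Equiv.Perm (Fin n), ℓ' (∏ i, u' (σ i) i) = ((Equiv.Perm.sign σ : ℤ) : ℂ)) ∧ Module.finrank ℂ R' ≤ 2 ^ ((Nat.log 2 (Module.finrank ℂ R + n) + c) ^ c))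 ∨ Summit.ValiantsHypothesis.ValiantsHypothesis.Theses.TwistedDetRank.TdrPerNotQP

/-- **Calibration S (the sibling crux `DirectSumExp` makes `tdr(per_n)` super-polynomial; provable now,
auxiliary).** Block restriction with `m = ⌊n/3⌋` and real analysis. [folklore] -/
def SuperpolyOfDirectSumExp : Prop :=
  Summit.ValiantsHypothesis.ValiantsHypothesis.Theses.TwistedDetRank.DirectSumExp → ∀ C : ℕ, ∃ n₀ : ℕ, ∀ n ≥ n₀, ∀ (r : ℕ) (E : Fin r → Matrix (Fin n) (Fin n) ℂ), Literature.Computability.AlgebraicComplexity.perPoly (Fin n) ℂ = ∑ t, (Matrix.of fun i j => MvPolynomial.C (E t i j) * MvPolynomial.X (i, j)).det → n ^ C < r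

/-- **Calibration S' (`DirectSumExp → SDimUnbounded`; provable now, auxiliary).** The sibling route's
rank-4 crux (stmt-6285) settles this route's rank-4 crux (stmt-7288) via the expansion bound.
[folklore] -/
def SDimUnboundedOfDirectSumExp : Prop :=
  Summit.ValiantsHypothesis.ValiantsHypothesis.Theses.TwistedDetRank.DirectSumExp → Summit.ValiantsHypothesis.ValiantsHypothesis.Theses.FermionizationDimension.SDimUnbounded

/-- **Calibration E_N (expansion bound with the NIL-INDEX in the exponent; provable now, auxiliary).**
A realisation of `sgn_n` of dimension `d` with `(nilradical R)^N = 0` gives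
`tdr(per_n) ≤ (n+1)^N · d^N` — polynomial in `d` for bounded nil-index: the bet J_tr can only be
carried by coefficient algebras whose nil-index grows faster than polylogarithmically (companions:
`stub_localExpansionNil`, `stub_globalExpansionNil` in the same landed file). [folklore] -/
def ExpansionBoundNil : Prop :=
  ∀ (n N : ℕ) (R : Type) [CommRing R] [Algebra ℂ R] [Module.Finite ℂ R] (u : Fin n → Fin n → R) (ℓ : R →ₗ[ℂ] ℂ), (∀ σ : Equiv.Perm (Fin n), ℓ (∏ i, u (σ i) i) = ((Equiv.Perm.sign σ : ℤ) : ℂ)) → nilradical R ^ N = ⊥ → ∃ r ≤ (n + 1) ^ N * Module.finrank ℂ R ^ N, ∃ E : Fin r → Matrix (Fin n) (Fin n) ℂ, Literature.Computability.AlgebraicComplexity.perPoly (Fin n) ℂ = ∑ t, (Matrix.of fun i j => MvPolynomial.C (E t i j) * MvPolynomial.X (i, j)).det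

/-! ## §2 The registered stubs (`sorry` lives ONLY here)

Composition stubs (rev 5): `stub_tdrPerNotQP` (X1_ss, open = stmt-6284) and
`stub_junkRigidityTransferSmall` (J_tr,small, the bet). Closed and wired in by import:
`stub_junkRigidityReduced` (J_red, p147106), `stub_junkRigidityTransferLarge` (p151357),
`stub_localExpansion` (p152060), `stub_globalExpansion` (p152485), `tdrPerNotQP_of_sDimPerNotQP`
(necessity of X1_ss, p150328). Also closed: `stub_expansionBound` (p152874), `stub_polylogTransfer` (p153231),
`stub_superpolyTransfer` (p153298), `stub_betOrSemisimple` (p153546), `stub_superpolyOfDirectSumExp` and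
`stub_sDimUnboundedOfDirectSumExp` (p154123), `stub_localExpansionNil` / `stub_globalExpansionNil` /
`stub_expansionBoundNil` (p154689) — all auxiliary calibration results, none a hypothesis of
`SDimPerNotQP_of`. Rev 8: the only sorries left are the two open composition stubs. -/

/-- Stub X1_ss (registered obligation; signature = `TdrPerNotQP` verbatim = item
stmt-ValiantsHypothesis-6284 verbatim). [conjecture-grade; MarcusMinc1961, MignonRessayre2004,
LoeblMasbaum2011, Tesler2000] -/
theorem stub_tdrPerNotQP :
    ¬ ∃ c : ℕ, ∀ n : ℕ, ∃ r ≤ 2 ^ ((Nat.log 2 n + c) ^ c), ∃ E : Fin r → Matrix (Fin n) (Fin n) ℂ, Literature.Computability.AlgebraicComplexity.perPoly (Fin n) ℂ = ∑ t, (Matrix.of fun i j => MvPolynomial.C (E t i j) * MvPolynomial.X (i, j)).det :=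
  -- CLOSED (rev 10): the sibling crux stmt-ValiantsHypothesis-6284 is proved in tree.
  Summit.ValiantsHypothesis.ValiantsHypothesis.Theorems.tdrPerNotQP_proof

/-- Stub J_red (registered obligation rev 2; signature = `JunkRigidityReduced` verbatim) — CLOSED:
landed as `Summit.ValiantsHypothesis.ValiantsHypothesis.Theorems.stub_junkRigidityReduced`
(Theorems/FermionizationDimensionSDimPerNotQPJunkRigidityReduced.lean, p147106, 2026-08-17).
[folklore; Artin–Wedderburn for commutative finite-dimensional reduced `ℂ`-algebras] -/
theorem stub_junkRigidityReduced : JunkRigidityReduced :=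
  Summit.ValiantsHypothesis.ValiantsHypothesis.Theorems.stub_junkRigidityReduced

/-! Stub J_tr,small (`JunkRigidityTransferSmall`, the route's bet) — WITHDRAWN in rev 10: the crux is
reached through `stub_expLowerBound` instead; J_tr,small stays conjecture-grade and unneeded
(it is implied by the now-proved exponential bound for `finrank R ≥ 2^{n^δ}` only via `n!`, and by
`BetOrSemisimple` it could never have been refuted). -/

/-- Stub J_tr,large (registered obligation rev 4; signature = `JunkRigidityTransferLarge` verbatim) —
CLOSED: landed as `Summit.ValiantsHypothesis.ValiantsHypothesis.Theorems.stub_junkRigidityTransferLarge`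
(Theorems/FermionizationDimensionSDimPerNotQPJunkRigidityTransferLarge.lean, p151357). [folklore] -/
theorem stub_junkRigidityTransferLarge : JunkRigidityTransferLarge :=
  Summit.ValiantsHypothesis.ValiantsHypothesis.Theorems.stub_junkRigidityTransferLarge

/-- Auxiliary stub L (rev 4; signature = `LocalExpansion` verbatim) — CLOSED: landed as
`Summit.ValiantsHypothesis.ValiantsHypothesis.Theorems.stub_localExpansion`
(Theorems/FermionizationDimensionSDimPerNotQPLocalExpansion.lean, p152060). [folklore] -/
theorem stub_localExpansion : LocalExpansion :=
  Summit.ValiantsHypothesis.ValiantsHypothesis.Theorems.stub_localExpansion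

/-- Auxiliary stub G (rev 4; signature = `GlobalExpansion` verbatim) — CLOSED: landed as
`Summit.ValiantsHypothesis.ValiantsHypothesis.Theorems.FermionizationDimensionSDimPerNotQPGlobalExpansion.stub_globalExpansion`
(Theorems/FermionizationDimensionSDimPerNotQPGlobalExpansion.lean, p152485). [folklore] -/
theorem stub_globalExpansion : GlobalExpansion :=
  Summit.ValiantsHypothesis.ValiantsHypothesis.Theorems.FermionizationDimensionSDimPerNotQPGlobalExpansion.stub_globalExpansion

/-- Auxiliary stub (registered rev 5; signature = `ExpansionBound` verbatim) — CLOSED: landed as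
`Summit.ValiantsHypothesis.ValiantsHypothesis.Theorems.stub_expansionBound` (Theorems/FermionizationDimensionSDimPerNotQPExpansionBound.lean, p152874). [folklore] -/
theorem stub_expansionBound : ExpansionBound :=
  Summit.ValiantsHypothesis.ValiantsHypothesis.Theorems.stub_expansionBound

/-- Auxiliary stub (registered rev 5; signature = `PolylogTransfer` verbatim) — CLOSED: landed as
`Summit.ValiantsHypothesis.ValiantsHypothesis.Theorems.stub_polylogTransfer` (Theorems/FermionizationDimensionSDimPerNotQPPolylogTransfer.lean, p153231). [folklore] -/
theorem stub_polylogTransfer : PolylogTransfer :=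
  Summit.ValiantsHypothesis.ValiantsHypothesis.Theorems.stub_polylogTransfer

/-- Auxiliary stub (registered rev 5; signature = `SuperpolyTransfer` verbatim) — CLOSED: landed as
`Summit.ValiantsHypothesis.ValiantsHypothesis.Theorems.stub_superpolyTransfer` (Theorems/FermionizationDimensionSDimPerNotQPSuperpolyTransfer.lean, p153298). [folklore] -/
theorem stub_superpolyTransfer : SuperpolyTransfer :=
  Summit.ValiantsHypothesis.ValiantsHypothesis.Theorems.stub_superpolyTransfer

/-- Auxiliary stub D (registered rev 6; signature = `BetOrSemisimple` verbatim) — CLOSED: landed as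
`Summit.ValiantsHypothesis.ValiantsHypothesis.Theorems.stub_betOrSemisimple` (Theorems/FermionizationDimensionSDimPerNotQPBetOrSemisimple.lean,
p153546). [folklore] -/
theorem stub_betOrSemisimple : BetOrSemisimple :=
  Summit.ValiantsHypothesis.ValiantsHypothesis.Theorems.stub_betOrSemisimple

/-- Auxiliary stub S (registered by stub-add; signature = `SuperpolyOfDirectSumExp` verbatim) — CLOSED:
landed as `Summit.ValiantsHypothesis.ValiantsHypothesis.Theorems.stub_superpolyOfDirectSumExp`
(Theorems/FermionizationDimensionSDimPerNotQPDirectSumExpTransfer.lean, p154123). [folklore] -/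
theorem stub_superpolyOfDirectSumExp : SuperpolyOfDirectSumExp :=
  Summit.ValiantsHypothesis.ValiantsHypothesis.Theorems.stub_superpolyOfDirectSumExp

/-- Auxiliary stub S' (registered by stub-add; signature = `SDimUnboundedOfDirectSumExp` verbatim) —
CLOSED: landed as `Summit.ValiantsHypothesis.ValiantsHypothesis.Theorems.stub_sDimUnboundedOfDirectSumExp` (same file, p154123). [folklore] -/
theorem stub_sDimUnboundedOfDirectSumExp : SDimUnboundedOfDirectSumExp :=
  Summit.ValiantsHypothesis.ValiantsHypothesis.Theorems.stub_sDimUnboundedOfDirectSumExp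

/-- Auxiliary stub E_N (registered by stub-add; signature = `ExpansionBoundNil` verbatim) — CLOSED:
landed as `Summit.ValiantsHypothesis.ValiantsHypothesis.Theorems.stub_expansionBoundNil` (Theorems/FermionizationDimensionSDimPerNotQPExpansionNil.lean,
p154689, with `stub_localExpansionNil`, `stub_globalExpansionNil`). [folklore] -/
theorem stub_expansionBoundNil : ExpansionBoundNil :=
  Summit.ValiantsHypothesis.ValiantsHypothesis.Theorems.stub_expansionBoundNil

/-- Auxiliary stub LB (registered rev 9 by lead c1, 2026-08-17; PROVABLE NOW — proof checked in
`work/stubs/LinearLowerBound.lean`, to land as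
`Theorems/FermionizationDimensionSDimPerNotQPLinearLowerBound.lean`): the **linear lower bound on the
commutative twisting dimension** — every commutative realisation `(R, u, ℓ)` of `sgn_n` has
`n ≤ 2 · finrank ℂ R`, i.e. `s(n) ≥ ⌈n/2⌉` (first bound beyond Marcus–Minc's `s(n) ≥ 2`). Descent by a
character `χ` of `R ⧸ Ann θ` on weighted realisations `ℓ (θ · ∏ u (σ i) i) = sgn σ`: restrict at an entry
with `χ (u j i) = 0`, or contract a `2 × 2` block with nonzero residue permanent (one exists among rows
`0,1` × columns `0,1,2`); the weight picks up a factor in `ker χ` and `finrank (θR)` drops strictly.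
Not a hypothesis of `SDimPerNotQP_of` (the crux needs super-quasi-polynomial growth); it is the
unconditional progress of this line toward the crux. [new; n = 3: MarcusMinc1961, BrualdiRyser1991
Thm 7.5.1] -/
theorem stub_linearLowerBound :
    ∀ (n : ℕ) (R : Type) [CommRing R] [Algebra ℂ R] [Module.Finite ℂ R] (u : Fin n → Fin n → R) (ℓ : R →ₗ[ℂ] ℂ), (∀ σ : Equiv.Perm (Fin n), ℓ (∏ i, u (σ i) i) = ((Equiv.Perm.sign σ : ℤ) : ℂ)) → n ≤ 2 * Module.finrank ℂ R :=
  -- CLOSED: landed p157177 (Theorems/FermionizationDimensionSDimPerNotQPLinearLowerBound.lean)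
  Summit.ValiantsHypothesis.ValiantsHypothesis.Theorems.stub_linearLowerBound

/-- Auxiliary stub U (registered rev 9 by lead c1, 2026-08-17; PROVABLE NOW, same file): the route's
rank-4 crux **`SDimUnbounded`** (stmt-ValiantsHypothesis-7288) — `s(n) → ∞`, with `n₀ = 2 s₀ + 1` — from
the linear lower bound. [new] -/
theorem stub_sDimUnbounded :
    Summit.ValiantsHypothesis.ValiantsHypothesis.Theses.FermionizationDimension.SDimUnbounded :=
  -- CLOSED: landed p157177 (same file)
  Summit.ValiantsHypothesis.ValiantsHypothesis.Theorems.stub_sDimUnbounded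

/-- **Stub EXP (registered rev 10 by lead c1, 2026-08-17; PROVABLE NOW — proof checked sorry-free in
`work/stubs/ExpLowerBound.lean`, landing as `Theorems/FermionizationDimensionSDimPerNotQPExpLowerBound.lean`):
the EXPONENTIAL lower bound on the commutative twisting dimension** — every commutative realisation
`(R, u, ℓ)` of `sgn_{3m}` has `3^m ≤ 2^m · finrank ℂ R` (`s(n) ≥ (3/2)^{⌊n/3⌋}`). Block restriction to
`𝔖_3^m`, the `3 × 3` determinantal flattening `T` of the Birkhoff cubic on `R`-valued cone points,
`ℓ_*(⊗_R T(U_b)) = L(sgn)^{⊗m}` (invertible); `T(U)` factors through `R²` when the entry `u₂₁` of the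
block is a unit, so the pushforward has rank `≤ 2^m · finrank R`; nilpotent entries by the
polynomial perturbation `u₂₁ + t`. THE load-bearing stub of rev 10. [new] -/
theorem stub_expLowerBound :
    ∀ (m : ℕ) (R : Type) [CommRing R] [Algebra ℂ R] [Module.Finite ℂ R] (u : Fin (m * 3) → Fin (m * 3) → R) (ℓ : R →ₗ[ℂ] ℂ), (∀ σ : Equiv.Perm (Fin (m * 3)), ℓ (∏ i, u (σ i) i) = ((Equiv.Perm.sign σ : ℤ) : ℂ)) → 3 ^ m ≤ 2 ^ m * Module.finrank ℂ R := by
  sorry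

/-! ## §3 Name-keyed aliases of the stub statements (hypotheses of the composition)

`Registered.stub_X` is the statement of `stub_X` under the registered stub's short name, so that the
native skeleton audit (`#h21_check_skeleton`: hypotheses admissible iff registered obligations /
declared stubs BY NAME) accepts `SDimPerNotQP_of : Registered.stub_… → … → SDimPerNotQP`
(device of `Cruxes/RestorationQP/Lines/birth.lean`). -/
namespace Registered

/-- Alias of `TdrPerNotQP` (= the signature of `stub_tdrPerNotQP`). -/
abbrev stub_tdrPerNotQP : Prop := TdrPerNotQP
/-- Alias of `JunkRigidityReduced` (= the signature of the closed stub `stub_junkRigidityReduced`). -/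
abbrev stub_junkRigidityReduced : Prop := JunkRigidityReduced
/-- Alias of `JunkRigidityTransferSmall` (= the signature of `stub_junkRigidityTransferSmall`). -/
abbrev stub_junkRigidityTransferSmall : Prop := JunkRigidityTransferSmall
/-- Alias of `JunkRigidityTransferLarge` (= the signature of `stub_junkRigidityTransferLarge`). -/
abbrev stub_junkRigidityTransferLarge : Prop := JunkRigidityTransferLarge
/-- The signature of `stub_expLowerBound` (rev 10), by name. -/
abbrev stub_expLowerBound : Prop :=
  ∀ (m : ℕ) (R : Type) [CommRing R] [Algebra ℂ R] [Module.Finite ℂ R] (u : Fin (m * 3) → Fin (m * 3) → R) (ℓ : R →ₗ[ℂ] ℂ), (∀ σ : Equiv.Perm (Fin (m * 3)), ℓ (∏ i, u (σ i) i) = ((Equiv.Perm.sign σ : ℤ) : ℂ)) → 3 ^ m ≤ 2 ^ m * Module.finrank ℂ R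

end Registered

/-! ## §4 Arithmetic of the composition (proved) -/

/-- `log₂` of a quasi-polynomially bounded quantity plus `n` is polylogarithmic:
if `d ≤ 2^A` with `A = (log₂ n + cs)^cs` then `log₂ (d + n) ≤ A + log₂ n + 2`. [folklore] -/
theorem log_add_le_of_le_qp (cs n d : ℕ) (hd : d ≤ 2 ^ ((Nat.log 2 n + cs) ^ cs)) :
    Nat.log 2 (d + n) ≤ (Nat.log 2 n + cs) ^ cs + Nat.log 2 n + 2 := by
  have hn : n < 2 ^ (Nat.log 2 n + 1) := Nat.lt_pow_succ_log_self Nat.one_lt_two n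
  generalize Nat.log 2 n = L at hn hd ⊢
  set A : ℕ := (L + cs) ^ cs with hA
  have h1 : d + n ≤ 2 ^ (A + L + 2) := by
    have hA' : 2 ^ A ≤ 2 ^ (A + L + 1) := Nat.pow_le_pow_right (by norm_num) (by omega)
    have hL' : 2 ^ (L + 1) ≤ 2 ^ (A + L + 1) := Nat.pow_le_pow_right (by norm_num) (by omega)
    have h2 : 2 ^ (A + L + 2) = 2 ^ (A + L + 1) * 2 := by
      rw [show A + L + 2 = (A + L + 1) + 1 by omega, pow_succ]
    omega
  calc Nat.log 2 (d + n) ≤ Nat.log 2 (2 ^ (A + L + 2)) := Nat.log_mono_right h1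
    _ = A + L + 2 := Nat.log_pow Nat.one_lt_two _

/-- Exponent absorption: a quasi-polynomial of a quasi-polynomial is a quasi-polynomial. For all
`cs c` there is `c'` with `2^((log₂(d + n) + c)^c) ≤ 2^((log₂ n + c')^c')` whenever
`d ≤ 2^((log₂ n + cs)^cs)`. [folklore; BCS 1997 Def. (21.31)] -/
theorem qp_compose (cs c : ℕ) : ∃ c' : ℕ, ∀ n d : ℕ, d ≤ 2 ^ ((Nat.log 2 n + cs) ^ cs) →
    2 ^ ((Nat.log 2 (d + n) + c) ^ c) ≤ 2 ^ ((Nat.log 2 n + c') ^ c') := by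
  refine ⟨(cs + 2) * (c + 1) + (cs + c + 2), fun n d hd => ?_⟩
  have hlog := log_add_le_of_le_qp cs n d hd
  apply Nat.pow_le_pow_right (by norm_num)
  generalize Nat.log 2 n = L at hlog ⊢
  generalize Nat.log 2 (d + n) = M at hlog ⊢
  set B : ℕ := cs + c + 2 with hB
  set c' : ℕ := (cs + 2) * (c + 1) + B with hc'
  have hB1 : 1 ≤ L + B := by omega
  -- the base: `M + c ≤ (L + B) ^ (cs + 2)`
  have hx : (L + cs) ^ cs ≤ (L + B) ^ (cs + 1) :=
    calc (L + cs) ^ cs ≤ (L + B) ^ cs := Nat.pow_le_pow_left (by omega) _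
      _ ≤ (L + B) ^ (cs + 1) := Nat.pow_le_pow_right hB1 (by omega)
  have hy : L + 2 + c ≤ (L + B) ^ (cs + 1) :=
    calc L + 2 + c ≤ L + B := by omega
      _ = (L + B) ^ 1 := (pow_one _).symm
      _ ≤ (L + B) ^ (cs + 1) := Nat.pow_le_pow_right hB1 (by omega)
  have hbase : M + c ≤ (L + B) ^ (cs + 2) :=
    calc M + c ≤ (L + cs) ^ cs + (L + 2 + c) := by omega
      _ ≤ (L + B) ^ (cs + 1) + (L + B) ^ (cs + 1) := Nat.add_le_add hx hy
      _ = 2 * (L + B) ^ (cs + 1) := by ring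
      _ ≤ (L + B) * (L + B) ^ (cs + 1) := Nat.mul_le_mul_right _ (by omega)
      _ = (L + B) ^ (cs + 2) := by ring
  -- the exponent
  calc (M + c) ^ c ≤ ((L + B) ^ (cs + 2)) ^ c := Nat.pow_le_pow_left hbase _
    _ = (L + B) ^ ((cs + 2) * c) := (pow_mul _ _ _).symm
    _ ≤ (L + c') ^ ((cs + 2) * c) := Nat.pow_le_pow_left (by omega) _
    _ ≤ (L + c') ^ c' := Nat.pow_le_pow_right (by omega) (by nlinarith)

/-! ## §5 The compositions (sorry-free) and the wiring check -/

/-- Monotonicity of the quasi-polynomial scale in the constant: `2^((L+c)^c) ≤ 2^((L+c')^c')` for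
`c ≤ c'`, `1 ≤ c'`. [folklore] -/
theorem qp_mono {c c' : ℕ} (h : c ≤ c') (h1 : 1 ≤ c') (L : ℕ) :
    2 ^ ((L + c) ^ c) ≤ 2 ^ ((L + c') ^ c') := by
  apply Nat.pow_le_pow_right (by norm_num)
  calc (L + c) ^ c ≤ (L + c') ^ c := Nat.pow_le_pow_left (by omega) _
    _ ≤ (L + c') ^ c' := Nat.pow_le_pow_right (by omega) h

/-- **J_tr from J_tr,small (and the landed J_tr,large)** (kernel-checked, no `sorry`): case split
on `finrank ℂ R < 2^n`, with the constant `max c 2`. [folklore] -/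
theorem junkRigidityTransfer_of :
    Registered.stub_junkRigidityTransferSmall → JunkRigidityTransfer := by
  intro hsmall
  -- J_tr,large is CLOSED (landed theorem)
  have hlarge : JunkRigidityTransferLarge := stub_junkRigidityTransferLarge
  obtain ⟨c, hc⟩ := hsmall
  refine ⟨max c 2, fun n R _ _ _ u ℓ hu => ?_⟩
  by_cases hd : Module.finrank ℂ R < 2 ^ n
  · obtain ⟨R', i1, i2, i3, i4, u', ℓ', hu', hdim⟩ := hc n R u ℓ hu hd
    exact ⟨R', i1, i2, i3, i4, u', ℓ', hu',
      hdim.trans (qp_mono (le_max_left c 2) (le_trans (by norm_num) (le_max_right c 2)) _)⟩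
  · obtain ⟨R', i1, i2, i3, i4, u', ℓ', hu', hdim⟩ := hlarge n (Module.finrank ℂ R) (Nat.le_of_not_lt hd)
    exact ⟨R', i1, i2, i3, i4, u', ℓ', hu',
      hdim.trans (qp_mono (le_max_right c 2) (le_trans (by norm_num) (le_max_right c 2)) _)⟩

/-- **J from J_tr (and the landed J_red)** (kernel-checked, no `sorry`): semisimplify the given
realisation at quasi-polynomial cost (J_tr), then read the reduced realisation as a sum of at most
`finrank R'` Hadamard-twisted determinants (J_red, landed theorem
`Summit.ValiantsHypothesis.ValiantsHypothesis.Theorems.stub_junkRigidityReduced`); the constant `c`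
of J is the constant of J_tr. [folklore] -/
theorem junkRigidityQP_of : JunkRigidityTransfer → JunkRigidityQP := by
  intro htr
  -- J_red is CLOSED: the landed theorem (Theorems/FermionizationDimensionSDimPerNotQPJunkRigidityReduced.lean)
  have hred : JunkRigidityReduced :=
    Summit.ValiantsHypothesis.ValiantsHypothesis.Theorems.stub_junkRigidityReduced
  obtain ⟨c, hc⟩ := htr
  refine ⟨c, fun n R _ _ _ u ℓ hu => ?_⟩
  obtain ⟨R', _, _, _, _, u', ℓ', hu', hdim⟩ := hc n R u ℓ hu
  obtain ⟨r, hr, E, hE⟩ := hred n R' u' ℓ' hu'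
  exact ⟨r, hr.trans hdim, E, hE⟩

/-- **Old composition (rev ≤ 9, kept as a conditional) — the crux from X1_ss and the bet J_tr,small**
(kernel-checked, no `sorry`; the closed stubs J_red and J_tr,large enter through `junkRigidityQP_of` /
`junkRigidityTransfer_of`):
X1_ss (semisimple lower bound beyond every quasi-polynomial) with J = J_red ∘ J_tr
(`junkRigidityQP_of`: semisimplification of any commutative realisation at quasi-polynomial cost)
give that the commutative twisting dimension of the permanent is not quasi-polynomially bounded.
Proof (the birth composition): for a qp-bounded `s`, if no `n` worked then every `n` has a
realisation of dimension `≤ s n`; J turns it into `≤ 2^((log₂(s n + n) + c)^c) ≤ 2^((log₂ n + c')^c')`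
twisted determinants (`qp_compose`), for every `n` — the negation of X1_ss. [folklore] -/
theorem SDimPerNotQP_of_semisimple :
    Registered.stub_tdrPerNotQP → Registered.stub_junkRigidityTransferSmall → SDimPerNotQP := by
  intro hT hsmall s hs
  have hJ : JunkRigidityQP := junkRigidityQP_of (junkRigidityTransfer_of hsmall)
  obtain ⟨cs, hcs⟩ := hs
  obtain ⟨c, hc⟩ := hJ
  obtain ⟨c', hc'⟩ := qp_compose cs c
  by_contra hcon
  apply hT
  refine ⟨c', fun n => ?_⟩
  -- no `n` works for `s`: in particular at this `n` some realisation has dimension `≤ s n`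
  have hsmall : ∃ (R : Type) (_ : CommRing R) (_ : Algebra ℂ R) (_ : Module.Finite ℂ R)
      (u : Fin n → Fin n → R) (ℓ : R →ₗ[ℂ] ℂ),
      (∀ σ : Equiv.Perm (Fin n), ℓ (∏ i, u (σ i) i) = ((Equiv.Perm.sign σ : ℤ) : ℂ)) ∧
        Module.finrank ℂ R ≤ s n := by
    by_contra hno
    apply hcon
    refine ⟨n, ?_⟩
    intro R _ _ _ u ℓ hu
    by_contra hlt
    exact hno ⟨R, inferInstance, inferInstance, inferInstance, u, ℓ, hu, Nat.le_of_not_lt hlt⟩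
  obtain ⟨R, _, _, _, u, ℓ, hu, hdim⟩ := hsmall
  obtain ⟨r, hr, E, hE⟩ := hc n R u ℓ hu
  exact ⟨r, hr.trans (hc' n _ (hdim.trans (hcs n))), E, hE⟩

/-- **Composition (rev 10) — the crux BY NAME from the single registered stub `stub_expLowerBound`**
(kernel-checked, no `sorry`): for a qp-bounded `s` with constant `c`, take `m` with
`2^((log₂ m + c+4)^(c+4)) · 2^m < 3^m` (`stub_expBeatsQP`, landed) and `n = 3m`; a realisation of
`sgn_n` of dimension `d` has `3^m ≤ 2^m d` (the stub), while
`s n ≤ 2^((log₂(3m) + c)^c) ≤ 2^((log₂ m + c+4)^(c+4))` (`tdrPerNotQP_qp_transfer`, landed), so `s n < d`.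
[new] -/
theorem SDimPerNotQP_of : Registered.stub_expLowerBound → SDimPerNotQP := by
  intro hexp s hs
  obtain ⟨c, hc⟩ := hs
  obtain ⟨m, hm⟩ :=
    Summit.ValiantsHypothesis.ValiantsHypothesis.Theorems.TwistedDetRankTdrPerNotQP.stub_expBeatsQP
      (c + 3 + 1)
  refine ⟨m * 3, fun R _ _ _ u ℓ hu => ?_⟩
  have h1 : 3 ^ m ≤ 2 ^ m * Module.finrank ℂ R := hexp m R u ℓ hu
  have h2 : s (m * 3) ≤ 2 ^ ((Nat.log 2 (m * 3) + c) ^ c) := hc _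
  have h3 := Summit.ValiantsHypothesis.ValiantsHypothesis.Theorems.tdrPerNotQP_qp_transfer m 3 c
  have h4 : 2 ^ m * 2 ^ ((Nat.log 2 m + (c + 3 + 1)) ^ (c + 3 + 1)) <
      2 ^ m * Module.finrank ℂ R := by
    rw [mul_comm (2 ^ m)]
    exact lt_of_lt_of_le hm h1
  have h5 := Nat.lt_of_mul_lt_mul_left h4
  omega

/-- Wiring check (rev 10): the registered stub feeds `SDimPerNotQP_of` exactly as stated, so the
skeleton is `SDimPerNotQP` closed modulo `stub_expLowerBound` (the only `sorry` left). -/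
example : SDimPerNotQP := SDimPerNotQP_of stub_expLowerBound

/-- The closed stub still matches its registered alias (documentation of rev 2 → rev 3). -/
example : Registered.stub_junkRigidityReduced := stub_junkRigidityReduced

end Summit.ValiantsHypothesis.ValiantsHypothesis.Cruxes.SDimPerNotQP.Birth
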